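import Literature.Algebra.EuclideanLattices.FccBccLattices
import HarnessLib

/-!
# Layer pinning: a hard sphere between complete close-packed layers sits at a hollow site

Topic `Literature/Geometry/DiscreteGeometry`.  Folklore geometry of the close packing of equal spheres
([folklore]; the «hollow» / «smallest possible distance» remark of [cite: HalesDSP2012, §1.3 p. 12] and the
deep holes of the hexagonal lattice `A₂` — minimal norm `1`, covering radius `R = 2ρ/√3 = 1/√3`, deep holes `(±½, ±1/(2√3))` — [cite: ConwaySloane1999, Ch. 4 §6.2, p. 110, eq. (58)]), typed for
the cell `crystal3d-full` (venture `Summits/Ventures/Crystal3D`, crux `CoaxialWallLaw`, planner decision R41u /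
regime (β1) «isolated one-fault-layer risers», 2026-08-28): the census-free fact that makes a faulted
close-packed layer between two complete layers an ON-LATTICE (hollow-site) object.

Coordinates as in `…GenericWallFloorCapRigidity` / `…CoaxialWallLawHexCapCount` of that venture: a close-packed
layer is `e₂`-normal («height» = coordinate `2`), its sites are `(c₀ + a + b/2, c₁ + b·√3/2, h)`, `a b : ℤ`
(nearest-neighbour distance `1`, hexagon directions `(±1,0,0), (±½,±√3/2,0)`).

* `triangular_covering_sq` — covering radius of the triangular lattice: every point of the plane is within
  squared distance `1/3` of a site (barycentric moment identity on one lattice triangle: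
  `Σ λᵢ |P − Vᵢ|² = Σ_{i<j} λᵢλⱼ ≤ 1/3`).
* `triangular_deep_holes` — equality case: a point at squared distance `≥ 1/3` from EVERY site is a hollow
  (centroid of a lattice triangle): `(a + b/2 + ½, b√3/2 + √3/6)` or `(a + b/2 + 1, b√3/2 + √3/3)`.
* `two_thirds_le_sq_height` — one complete layer at height `h`, a point `q` at distance `≥ 1` from all its
  sites ⇒ `(q₂ − h)² ≥ 2/3` (the layer spacing `d₁₁₁ = √(2/3)` is the least height of a ball over a layer).
* `layer_pinning` — two complete layers at heights `h₀ < h₂`, a point strictly between at distance `≥ 1`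
  from all sites of both ⇒ `√(2/3) ≤ q₂ − h₀` and `√(2/3) ≤ h₂ − q₂` (so `h₂ − h₀ ≥ 2√(2/3)`); at the minimal
  separation `h₂ − h₀ = 2√(2/3)` the point is at mid-height over a HOLLOW of the lower layer
  (`layer_pinning_hollow`) and touches the three sites around it (`layer_pinning_contacts`).
* `…_local` (§4) — the same with the hard core asked only for the (≤ 3) sites within planar distance `1/√3`
  of the ball's foot (the form usable for finite packings).
* `card_layer_contacts_le_two` (§5) — above mid-height (`(q₂ − h)² > 2/3`) a ball touches at most TWO balls of a
  complete layer (three only at a hollow).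
* `layer_pinning_three` — separation `3√(2/3)` (two layers between complete layers: the Σ3 twin-wall period):
  every ball strictly between lies in the closed middle slab `[h₀ + √(2/3), h₀ + 2√(2/3)]`; on a slab face it
  is over a hollow of the adjacent complete layer (`layer_pinning_hollow` applies).

Precedent inside the venture (not importable upstream): `Summit.Ventures.Crystal3D.Theorems.triangular_covering`
(`…NoReconstructionGainBlanketGlue`, same site parametrisation) proves the covering inequality by bracketing rows;
here it is re-derived from the one-triangle moment identity, which also yields the deep-hole equality case.

WHAT THIS IS NOT: nothing about which hollows are occupied (the 2D exclusion count of regime (β1b)); no wall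
statement.
-/

noncomputable section

namespace Literature.Geometry.DiscreteGeometry

open Real
open Literature.Algebra.EuclideanLattices (norm_sq_fin_three)

/-! ## 1. One lattice triangle: the moment identity and its two consequences -/

/-- Moment identity for the point `P = s·e₁ + t·e₂` of the unit equilateral triangle `0, e₁ = (1,0),
e₂ = (½, √3/2)` (barycentric coordinates `(1−s−t, s, t)`):
`(1−s−t)|P|² + s|P−e₁|² + t|P−e₂|² = (1−s−t)s + (1−s−t)t + st`, with `|P|² = s² + st + t²`,
`|P − e₁|² = (s−1)² + (s−1)t + t²`, `|P − e₂|² = s² + s(t−1) + (t−1)²`. [folklore] -/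
private theorem triangle_moment_identity (s t : ℝ) :
    (1 - s - t) * (s ^ 2 + s * t + t ^ 2) + s * ((s - 1) ^ 2 + (s - 1) * t + t ^ 2)
      + t * (s ^ 2 + s * (t - 1) + (t - 1) ^ 2) = (1 - s - t) * s + (1 - s - t) * t + s * t := by
  ring

/-- In the closed triangle (`0 ≤ s`, `0 ≤ t`, `s + t ≤ 1`) some vertex is within squared distance `1/3`.
[folklore] -/
private theorem triangle_covering (s t : ℝ) (hs : 0 ≤ s) (ht : 0 ≤ t) (hst : s + t ≤ 1) :
    s ^ 2 + s * t + t ^ 2 ≤ 1 / 3 ∨ (s - 1) ^ 2 + (s - 1) * t + t ^ 2 ≤ 1 / 3 ∨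
      s ^ 2 + s * (t - 1) + (t - 1) ^ 2 ≤ 1 / 3 := by
  by_contra h
  simp only [not_or, not_le] at h
  obtain ⟨h0, h1, h2⟩ := h
  have hid := triangle_moment_identity s t
  have he2 : (1 - s - t) * s + (1 - s - t) * t + s * t ≤ 1 / 3 := by
    nlinarith [sq_nonneg (s - t), sq_nonneg (1 - s - t - s), sq_nonneg (1 - s - t - t)]
  have hl0 : 0 ≤ 1 - s - t := by linarith
  nlinarith [mul_nonneg hl0 (le_of_lt (sub_pos.2 h0)), mul_nonneg hs (le_of_lt (sub_pos.2 h1)),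
    mul_nonneg ht (le_of_lt (sub_pos.2 h2))]

/-- Equality case: all three vertices at squared distance `≥ 1/3` forces the centroid `s = t = 1/3`.
[folklore] -/
private theorem triangle_deep_hole (s t : ℝ) (hs : 0 ≤ s) (ht : 0 ≤ t) (hst : s + t ≤ 1)
    (h0 : 1 / 3 ≤ s ^ 2 + s * t + t ^ 2) (h1 : 1 / 3 ≤ (s - 1) ^ 2 + (s - 1) * t + t ^ 2)
    (h2 : 1 / 3 ≤ s ^ 2 + s * (t - 1) + (t - 1) ^ 2) : s = 1 / 3 ∧ t = 1 / 3 := by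
  have hid := triangle_moment_identity s t
  have hl0 : 0 ≤ 1 - s - t := by linarith
  have hge : 1 / 3 ≤ (1 - s - t) * s + (1 - s - t) * t + s * t := by
    nlinarith [mul_nonneg hl0 (sub_nonneg.2 h0), mul_nonneg hs (sub_nonneg.2 h1),
      mul_nonneg ht (sub_nonneg.2 h2)]
  have hsq : (s - 1 / 3) ^ 2 + (t - 1 / 3) ^ 2 + (1 - s - t - 1 / 3) ^ 2 ≤ 0 := by nlinarith
  have hs' : (s - 1 / 3) ^ 2 = 0 := by
    nlinarith [sq_nonneg (s - 1 / 3), sq_nonneg (t - 1 / 3), sq_nonneg (1 - s - t - 1 / 3)]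
  have ht' : (t - 1 / 3) ^ 2 = 0 := by
    nlinarith [sq_nonneg (s - 1 / 3), sq_nonneg (t - 1 / 3), sq_nonneg (1 - s - t - 1 / 3)]
  exact ⟨by linarith [pow_eq_zero_iff (n := 2) two_ne_zero |>.1 hs'],
    by linarith [pow_eq_zero_iff (n := 2) two_ne_zero |>.1 ht']⟩

/-! ## 2. The triangular lattice `{(a + b/2, b√3/2) : a b ∈ ℤ}`: covering radius and deep holes -/

/-- Squared distance from `(x, y) = (α + β/2, β√3/2)` to the site `(a + b/2, b√3/2)` in lattice
coordinates: `u² + uv + v²` with `u = α − a`, `v = β − b`. [folklore] -/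
private theorem triangular_dist_sq (α β a b : ℝ) :
    (α + β / 2 - (a + b / 2)) ^ 2 + (β * (Real.sqrt 3 / 2) - b * (Real.sqrt 3 / 2)) ^ 2
      = (α - a) ^ 2 + (α - a) * (β - b) + (β - b) ^ 2 := by
  have h3 : Real.sqrt 3 ^ 2 = 3 := Real.sq_sqrt (by norm_num)
  linear_combination ((β - b) ^ 2 / 4) * h3

/-- **Covering radius of the triangular lattice is `1/√3`**: every point of the plane is within squared
distance `1/3` of some site `(a + b/2, b·√3/2)`, `a b : ℤ`. [cite: ConwaySloane1999, Ch. 4 §6.2, p. 110 (`R = 2ρ/√3`)] -/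
theorem triangular_covering_sq (x y : ℝ) :
    ∃ a b : ℤ, (x - (a + b / 2)) ^ 2 + (y - b * (Real.sqrt 3 / 2)) ^ 2 ≤ 1 / 3 := by
  have hr : Real.sqrt 3 ≠ 0 := Real.sqrt_ne_zero'.2 (by norm_num)
  set β : ℝ := 2 * y / Real.sqrt 3 with hβ
  set α : ℝ := x - β / 2 with hα
  have hy : y = β * (Real.sqrt 3 / 2) := by rw [hβ]; field_simp
  have hx : x = α + β / 2 := by rw [hα]; ring
  set a0 : ℤ := ⌊α⌋
  set b0 : ℤ := ⌊β⌋
  set s : ℝ := α - a0 with hs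
  set t : ℝ := β - b0 with ht
  have hs0 : 0 ≤ s := sub_nonneg.2 (Int.floor_le α)
  have hs1 : s < 1 := by have := Int.lt_floor_add_one α; rw [hs]; linarith
  have ht0 : 0 ≤ t := sub_nonneg.2 (Int.floor_le β)
  have ht1 : t < 1 := by have := Int.lt_floor_add_one β; rw [ht]; linarith
  -- squared distance to the corner `(a0 + i, b0 + j)` of the cell
  have hc : ∀ i j : ℝ, (x - ((a0 : ℝ) + i + ((b0 : ℝ) + j) / 2)) ^ 2
      + (y - ((b0 : ℝ) + j) * (Real.sqrt 3 / 2)) ^ 2 = (s - i) ^ 2 + (s - i) * (t - j) + (t - j) ^ 2 := by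
    intro i j
    have e := triangular_dist_sq α β ((a0 : ℝ) + i) ((b0 : ℝ) + j)
    rw [hx, hy]
    have e1 : s - i = α - ((a0 : ℝ) + i) := by rw [hs]; ring
    have e2 : t - j = β - ((b0 : ℝ) + j) := by rw [ht]; ring
    rw [e1, e2, ← e]
  rcases le_or_gt (s + t) 1 with hle | hgt
  · rcases triangle_covering s t hs0 ht0 hle with h | h | h
    · refine ⟨a0, b0, ?_⟩; have := hc 0 0; simp only [add_zero, sub_zero] at this; linarith
    · refine ⟨a0 + 1, b0, ?_⟩; push_cast; have := hc 1 0; simp only [add_zero, sub_zero] at this; linarith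
    · refine ⟨a0, b0 + 1, ?_⟩; push_cast; have := hc 0 1; simp only [add_zero] at this; linarith
  · have hle' : (1 - s) + (1 - t) ≤ 1 := by linarith
    rcases triangle_covering (1 - s) (1 - t) (by linarith) (by linarith) hle' with h | h | h
    · refine ⟨a0 + 1, b0 + 1, ?_⟩; push_cast; have := hc 1 1; nlinarith
    · refine ⟨a0, b0 + 1, ?_⟩; push_cast; have := hc 0 1; simp only [add_zero] at this; nlinarith
    · refine ⟨a0 + 1, b0, ?_⟩; push_cast; have := hc 1 0; simp only [add_zero, sub_zero] at this; nlinarith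


/-- **Deep holes of the triangular lattice are the hollows.**  A point of the plane at squared distance
`≥ 1/3` from EVERY site `(a + b/2, b·√3/2)` is the centroid of a lattice triangle: an «up» hollow
`(a + b/2 + ½, b√3/2 + √3/6)` or a «down» hollow `(a + b/2 + 1, b√3/2 + √3/3)` (the two hollow cosets,
i.e. the `B` and `C` positions over an `A` layer). [cite: ConwaySloane1999, Ch. 4 §6.2, p. 110 (deep holes `(±½, ±1/(2√3))`)] -/
theorem triangular_deep_holes (x y : ℝ)
    (hfar : ∀ a b : ℤ, 1 / 3 ≤ (x - (a + b / 2)) ^ 2 + (y - b * (Real.sqrt 3 / 2)) ^ 2) :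
    ∃ a b : ℤ, (x = a + b / 2 + 1 / 2 ∧ y = b * (Real.sqrt 3 / 2) + Real.sqrt 3 / 6) ∨
      (x = a + b / 2 + 1 ∧ y = b * (Real.sqrt 3 / 2) + Real.sqrt 3 / 3) := by
  have hr : Real.sqrt 3 ≠ 0 := Real.sqrt_ne_zero'.2 (by norm_num)
  set β : ℝ := 2 * y / Real.sqrt 3 with hβ
  set α : ℝ := x - β / 2 with hα
  have hy : y = β * (Real.sqrt 3 / 2) := by rw [hβ]; field_simp
  have hx : x = α + β / 2 := by rw [hα]; ring
  set a0 : ℤ := ⌊α⌋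
  set b0 : ℤ := ⌊β⌋
  set s : ℝ := α - a0 with hs
  set t : ℝ := β - b0 with ht
  have hs0 : 0 ≤ s := sub_nonneg.2 (Int.floor_le α)
  have hs1 : s < 1 := by have := Int.lt_floor_add_one α; rw [hs]; linarith
  have ht0 : 0 ≤ t := sub_nonneg.2 (Int.floor_le β)
  have ht1 : t < 1 := by have := Int.lt_floor_add_one β; rw [ht]; linarith
  have hc : ∀ i j : ℝ, (x - ((a0 : ℝ) + i + ((b0 : ℝ) + j) / 2)) ^ 2
      + (y - ((b0 : ℝ) + j) * (Real.sqrt 3 / 2)) ^ 2 = (s - i) ^ 2 + (s - i) * (t - j) + (t - j) ^ 2 := by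
    intro i j
    have e := triangular_dist_sq α β ((a0 : ℝ) + i) ((b0 : ℝ) + j)
    rw [hx, hy]
    have e1 : s - i = α - ((a0 : ℝ) + i) := by rw [hs]; ring
    have e2 : t - j = β - ((b0 : ℝ) + j) := by rw [ht]; ring
    rw [e1, e2, ← e]
  have d00 := hfar a0 b0
  have d10 := hfar (a0 + 1) b0
  have d01 := hfar a0 (b0 + 1)
  have d11 := hfar (a0 + 1) (b0 + 1)
  push_cast at d00 d10 d01 d11
  have c00 := hc 0 0; have c10 := hc 1 0; have c01 := hc 0 1; have c11 := hc 1 1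
  simp only [add_zero, sub_zero] at c00 c10 c01
  rw [c00] at d00; rw [c10] at d10; rw [c01] at d01; rw [c11] at d11
  refine ⟨a0, b0, ?_⟩
  rcases le_or_gt (s + t) 1 with hle | hgt
  · obtain ⟨hs3, ht3⟩ := triangle_deep_hole s t hs0 ht0 hle d00 d10 d01
    left
    have hb : β = b0 + 1 / 3 := by linarith
    exact ⟨by linarith, by rw [hy, hb]; ring⟩
  · have e0 : (1 - s) ^ 2 + (1 - s) * (1 - t) + (1 - t) ^ 2
        = (s - 1) ^ 2 + (s - 1) * (t - 1) + (t - 1) ^ 2 := by ring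
    have e1 : (1 - s - 1) ^ 2 + (1 - s - 1) * (1 - t) + (1 - t) ^ 2
        = s ^ 2 + s * (t - 1) + (t - 1) ^ 2 := by ring
    have e2 : (1 - s) ^ 2 + (1 - s) * (1 - t - 1) + (1 - t - 1) ^ 2
        = (s - 1) ^ 2 + (s - 1) * t + t ^ 2 := by ring
    obtain ⟨hs3, ht3⟩ := triangle_deep_hole (1 - s) (1 - t) (by linarith) (by linarith) (by linarith)
      (by rw [e0]; exact d11) (by rw [e1]; exact d01) (by rw [e2]; exact d10)
    right
    have hb : β = b0 + 2 / 3 := by linarith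
    exact ⟨by linarith, by rw [hy, hb]; ring⟩

/-! ## 3. Balls over complete close-packed layers in `ℝ³` -/

/-- One site: hard core `‖q − p‖ ≥ 1` and lateral squared distance `≤ 1/3` force squared height `≥ 2/3`
(unit balls: Hales's radius-`1` balls at «distance 2», rescaled). [cite: HalesDSP2012, §1.3 p. 12 (Fig. 1.12)] -/
theorem two_thirds_le_sq_height_of_site (q p : EuclideanSpace ℝ (Fin 3)) (hcore : 1 ≤ ‖q - p‖)
    (hlat : (q 0 - p 0) ^ 2 + (q 1 - p 1) ^ 2 ≤ 1 / 3) : 2 / 3 ≤ (q 2 - p 2) ^ 2 := by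
  have hn := norm_sq_fin_three (q - p)
  simp only [PiLp.sub_apply] at hn
  nlinarith

/-- A complete close-packed layer at height `h` (sites `(c₀ + a + b/2, c₁ + b·√3/2, h)`, all `a b : ℤ`, each
carrying a ball at distance `≥ 1` from `q`): the ball `q` has squared height `(q₂ − h)² ≥ 2/3` over it —
the interlayer spacing `d₁₁₁ = √(2/3)` is the closest a ball can come to a complete layer
(«the smallest possible distance from first layer»). [cite: HalesDSP2012, §1.3 p. 12 (Fig. 1.12)] -/
theorem two_thirds_le_sq_height (q : EuclideanSpace ℝ (Fin 3)) (c₀ c₁ h : ℝ)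
    (hlayer : ∀ a b : ℤ, ∃ p : EuclideanSpace ℝ (Fin 3),
      p 0 = c₀ + a + b / 2 ∧ p 1 = c₁ + b * (Real.sqrt 3 / 2) ∧ p 2 = h ∧ 1 ≤ ‖q - p‖) :
    2 / 3 ≤ (q 2 - h) ^ 2 := by
  obtain ⟨a, b, hab⟩ := triangular_covering_sq (q 0 - c₀) (q 1 - c₁)
  obtain ⟨p, h0, h1, h2, hq⟩ := hlayer a b
  have e : (q 0 - p 0) ^ 2 + (q 1 - p 1) ^ 2
      = (q 0 - c₀ - (a + b / 2)) ^ 2 + (q 1 - c₁ - b * (Real.sqrt 3 / 2)) ^ 2 := by rw [h0, h1]; ring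
  have := two_thirds_le_sq_height_of_site q p hq (by linarith)
  rwa [h2] at this

/-- **Layer pinning.**  Two complete close-packed layers at heights `h₀ < h₂` (any lateral offsets) and a
ball strictly between them at distance `≥ 1` from every ball of both: it is at least `d₁₁₁ = √(2/3)` above
the lower and below the upper layer.  Hence `h₂ − h₀ ≥ 2√(2/3)`, with the equality case pinned at
mid-height (`layer_pinning_hollow`). [cite: HalesDSP2012, §1.3 p. 12 (Fig. 1.12)] -/
theorem layer_pinning (q : EuclideanSpace ℝ (Fin 3)) (c₀ c₁ h₀ c₀' c₁' h₂ : ℝ)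
    (hq₀ : h₀ < q 2) (hq₂ : q 2 < h₂)
    (hlow : ∀ a b : ℤ, ∃ p : EuclideanSpace ℝ (Fin 3),
      p 0 = c₀ + a + b / 2 ∧ p 1 = c₁ + b * (Real.sqrt 3 / 2) ∧ p 2 = h₀ ∧ 1 ≤ ‖q - p‖)
    (hup : ∀ a b : ℤ, ∃ p : EuclideanSpace ℝ (Fin 3),
      p 0 = c₀' + a + b / 2 ∧ p 1 = c₁' + b * (Real.sqrt 3 / 2) ∧ p 2 = h₂ ∧ 1 ≤ ‖q - p‖) :
    Real.sqrt (2 / 3) ≤ q 2 - h₀ ∧ Real.sqrt (2 / 3) ≤ h₂ - q 2 := by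
  have h1 := two_thirds_le_sq_height q c₀ c₁ h₀ hlow
  have h2 := two_thirds_le_sq_height q c₀' c₁' h₂ hup
  have h2' : 2 / 3 ≤ (h₂ - q 2) ^ 2 := by nlinarith
  constructor
  · have := Real.sqrt_le_sqrt h1
    rwa [Real.sqrt_sq (by linarith)] at this
  · have := Real.sqrt_le_sqrt h2'
    rwa [Real.sqrt_sq (by linarith)] at this

/-- Corollary: two complete layers with a ball strictly between them are `≥ 2 d₁₁₁ = 2√(2/3)` apart.
[cite: HalesDSP2012, §1.3 p. 12 (Fig. 1.12)] -/
theorem layer_gap_ge (q : EuclideanSpace ℝ (Fin 3)) (c₀ c₁ h₀ c₀' c₁' h₂ : ℝ)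
    (hq₀ : h₀ < q 2) (hq₂ : q 2 < h₂)
    (hlow : ∀ a b : ℤ, ∃ p : EuclideanSpace ℝ (Fin 3),
      p 0 = c₀ + a + b / 2 ∧ p 1 = c₁ + b * (Real.sqrt 3 / 2) ∧ p 2 = h₀ ∧ 1 ≤ ‖q - p‖)
    (hup : ∀ a b : ℤ, ∃ p : EuclideanSpace ℝ (Fin 3),
      p 0 = c₀' + a + b / 2 ∧ p 1 = c₁' + b * (Real.sqrt 3 / 2) ∧ p 2 = h₂ ∧ 1 ≤ ‖q - p‖) :
    2 * Real.sqrt (2 / 3) ≤ h₂ - h₀ := by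
  obtain ⟨h1, h2⟩ := layer_pinning q c₀ c₁ h₀ c₀' c₁' h₂ hq₀ hq₂ hlow hup
  linarith

/-- **Pinning at the minimal separation.**  If the two complete layers are exactly `2 d₁₁₁ = 2√(2/3)` apart,
a ball strictly between them sits at mid-height `q₂ = h₀ + √(2/3)` and its foot is a HOLLOW of the lower layer:
`(c₀ + a + b/2 + ½, c₁ + b√3/2 + √3/6)` or `(c₀ + a + b/2 + 1, c₁ + b√3/2 + √3/3)` for some `a b : ℤ`
(by symmetry also a hollow of the upper layer): Hales's sites `B`/`C` over an `A` layer, the deep holes of `A₂`.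
[cite: HalesDSP2012, §1.3 p. 12 (Fig. 1.12)] [cite: ConwaySloane1999, Ch. 4 §6.2, p. 110] -/
theorem layer_pinning_hollow (q : EuclideanSpace ℝ (Fin 3)) (c₀ c₁ h₀ c₀' c₁' h₂ : ℝ)
    (hq₀ : h₀ < q 2) (hq₂ : q 2 < h₂) (hsep : h₂ - h₀ = 2 * Real.sqrt (2 / 3))
    (hlow : ∀ a b : ℤ, ∃ p : EuclideanSpace ℝ (Fin 3),
      p 0 = c₀ + a + b / 2 ∧ p 1 = c₁ + b * (Real.sqrt 3 / 2) ∧ p 2 = h₀ ∧ 1 ≤ ‖q - p‖)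
    (hup : ∀ a b : ℤ, ∃ p : EuclideanSpace ℝ (Fin 3),
      p 0 = c₀' + a + b / 2 ∧ p 1 = c₁' + b * (Real.sqrt 3 / 2) ∧ p 2 = h₂ ∧ 1 ≤ ‖q - p‖) :
    q 2 = h₀ + Real.sqrt (2 / 3) ∧
      ∃ a b : ℤ, (q 0 = c₀ + a + b / 2 + 1 / 2 ∧ q 1 = c₁ + b * (Real.sqrt 3 / 2) + Real.sqrt 3 / 6) ∨
        (q 0 = c₀ + a + b / 2 + 1 ∧ q 1 = c₁ + b * (Real.sqrt 3 / 2) + Real.sqrt 3 / 3) := by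
  obtain ⟨h1, h2⟩ := layer_pinning q c₀ c₁ h₀ c₀' c₁' h₂ hq₀ hq₂ hlow hup
  have hz : q 2 = h₀ + Real.sqrt (2 / 3) := by linarith
  refine ⟨hz, ?_⟩
  have hsq : (q 2 - h₀) ^ 2 = 2 / 3 := by
    rw [hz, add_sub_cancel_left, Real.sq_sqrt (by norm_num)]
  -- every lower site is at lateral squared distance `≥ 1/3`
  have hfar : ∀ a b : ℤ, 1 / 3 ≤ (q 0 - c₀ - (a + b / 2)) ^ 2 + (q 1 - c₁ - b * (Real.sqrt 3 / 2)) ^ 2 := by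
    intro a b
    obtain ⟨p, h0, h1', h2', hq⟩ := hlow a b
    have hn := norm_sq_fin_three (q - p)
    simp only [PiLp.sub_apply] at hn
    rw [h0, h1', h2'] at hn
    have h1sq : 1 ≤ ‖q - p‖ ^ 2 := by nlinarith [norm_nonneg (q - p)]
    nlinarith
  obtain ⟨a, b, hab⟩ := triangular_deep_holes (q 0 - c₀) (q 1 - c₁) hfar
  refine ⟨a, b, ?_⟩
  rcases hab with ⟨hx, hy⟩ | ⟨hx, hy⟩
  · exact Or.inl ⟨by linarith, by linarith⟩
  · exact Or.inr ⟨by linarith, by linarith⟩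

/-- Contacts at a pinned position: a ball at height `√(2/3)` over a layer ball with lateral squared distance
`1/3` touches it (`‖q − p‖ = 1`).  At an «up» hollow `(a + b/2 + ½, b√3/2 + √3/6)` these are the three
sites `(a,b), (a+1,b), (a,b+1)`; at a «down» hollow `(a + b/2 + 1, b√3/2 + √3/3)` the sites
`(a+1,b), (a,b+1), (a+1,b+1)` (lateral offsets `(±½, ±√3/6)`, `(0, ±√3/3)`): «distance 2 from three
different points of L» in Hales's radius-`1` normalisation. [cite: HalesDSP2012, §1.3 p. 12 (Fig. 1.12)] -/
theorem layer_pinning_contact (q p : EuclideanSpace ℝ (Fin 3)) (hz : (q 2 - p 2) ^ 2 = 2 / 3)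
    (hlat : (q 0 - p 0) ^ 2 + (q 1 - p 1) ^ 2 = 1 / 3) : ‖q - p‖ = 1 := by
  have hn := norm_sq_fin_three (q - p)
  simp only [PiLp.sub_apply] at hn
  have h1 : ‖q - p‖ ^ 2 = 1 := by rw [hn]; linarith
  have h0 : 0 ≤ ‖q - p‖ := norm_nonneg _
  nlinarith

/-- The three lateral offsets around an «up» hollow and a «down» hollow have squared length `1/3`
(so `layer_pinning_contact` applies to each): `(½)² + (√3/6)² = (√3/3)² = 1/3` — the deep holes
`(±½, ±1/(2√3))` of `A₂` at covering radius `1/√3`. [cite: ConwaySloane1999, Ch. 4 §6.2, p. 110] -/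
theorem hollow_lateral_sq :
    (1 / 2 : ℝ) ^ 2 + (Real.sqrt 3 / 6) ^ 2 = 1 / 3 ∧ (0 : ℝ) ^ 2 + (Real.sqrt 3 / 3) ^ 2 = 1 / 3 := by
  have h3 : Real.sqrt 3 ^ 2 = 3 := Real.sq_sqrt (by norm_num)
  constructor <;> nlinarith [h3]

/-- **The Σ3 twin-wall period.**  Two complete layers `3 d₁₁₁ = 3√(2/3)` apart (the common `A` layers of a
`(111)` twin pair with `t_z ∈ d₁₁₁ℤ`): every ball strictly between them, at distance `≥ 1` from all balls of
both, lies in the closed middle slab `h₀ + √(2/3) ≤ q₂ ≤ h₀ + 2√(2/3)`; a ball ON a slab face is at the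
minimal height over the adjacent complete layer, hence over one of its hollows (`hollow_of_minimal_height`).
[cite: HalesDSP2012, §1.3 p. 12 (Fig. 1.12)] -/
theorem layer_pinning_three (q : EuclideanSpace ℝ (Fin 3)) (c₀ c₁ h₀ c₀' c₁' h₃ : ℝ)
    (hq₀ : h₀ < q 2) (hq₃ : q 2 < h₃) (hsep : h₃ - h₀ = 3 * Real.sqrt (2 / 3))
    (hlow : ∀ a b : ℤ, ∃ p : EuclideanSpace ℝ (Fin 3),
      p 0 = c₀ + a + b / 2 ∧ p 1 = c₁ + b * (Real.sqrt 3 / 2) ∧ p 2 = h₀ ∧ 1 ≤ ‖q - p‖)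
    (hup : ∀ a b : ℤ, ∃ p : EuclideanSpace ℝ (Fin 3),
      p 0 = c₀' + a + b / 2 ∧ p 1 = c₁' + b * (Real.sqrt 3 / 2) ∧ p 2 = h₃ ∧ 1 ≤ ‖q - p‖) :
    h₀ + Real.sqrt (2 / 3) ≤ q 2 ∧ q 2 ≤ h₀ + 2 * Real.sqrt (2 / 3) := by
  obtain ⟨h1, h2⟩ := layer_pinning q c₀ c₁ h₀ c₀' c₁' h₃ hq₀ hq₃ hlow hup
  constructor <;> linarith

/-- On the lower face of that slab (`q₂ = h₀ + √(2/3)`) the ball is over a hollow of the lower layer (site `B`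
or `C` of Fig. 1.12). [cite: HalesDSP2012, §1.3 p. 12 (Fig. 1.12)] [cite: ConwaySloane1999, Ch. 4 §6.2, p. 110] -/
theorem hollow_of_minimal_height (q : EuclideanSpace ℝ (Fin 3)) (c₀ c₁ h₀ : ℝ)
    (hz : q 2 = h₀ + Real.sqrt (2 / 3))
    (hlow : ∀ a b : ℤ, ∃ p : EuclideanSpace ℝ (Fin 3),
      p 0 = c₀ + a + b / 2 ∧ p 1 = c₁ + b * (Real.sqrt 3 / 2) ∧ p 2 = h₀ ∧ 1 ≤ ‖q - p‖) :
    ∃ a b : ℤ, (q 0 = c₀ + a + b / 2 + 1 / 2 ∧ q 1 = c₁ + b * (Real.sqrt 3 / 2) + Real.sqrt 3 / 6) ∨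
      (q 0 = c₀ + a + b / 2 + 1 ∧ q 1 = c₁ + b * (Real.sqrt 3 / 2) + Real.sqrt 3 / 3) := by
  have hsq : (q 2 - h₀) ^ 2 = 2 / 3 := by
    rw [hz, add_sub_cancel_left, Real.sq_sqrt (by norm_num)]
  have hfar : ∀ a b : ℤ, 1 / 3 ≤ (q 0 - c₀ - (a + b / 2)) ^ 2 + (q 1 - c₁ - b * (Real.sqrt 3 / 2)) ^ 2 := by
    intro a b
    obtain ⟨p, h0, h1', h2', hq⟩ := hlow a b
    have hn := norm_sq_fin_three (q - p)
    simp only [PiLp.sub_apply] at hn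
    rw [h0, h1', h2'] at hn
    have h1sq : 1 ≤ ‖q - p‖ ^ 2 := by nlinarith [norm_nonneg (q - p)]
    nlinarith
  obtain ⟨a, b, hab⟩ := triangular_deep_holes (q 0 - c₀) (q 1 - c₁) hfar
  refine ⟨a, b, ?_⟩
  rcases hab with ⟨hx, hy⟩ | ⟨hx, hy⟩
  · exact Or.inl ⟨by linarith, by linarith⟩
  · exact Or.inr ⟨by linarith, by linarith⟩

/-! ## 4. Local forms: only the sites within planar distance `1/√3` of the ball's foot matter

For a FINITE packing `X` no layer is complete; what the proofs above use is only the covering site(s) of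
`q`'s foot.  The `_local` forms below ask the hard-core inequality `1 ≤ ‖q − p‖` only for the sites `p` of the
layer at planar squared distance `≤ 1/3` from `q` (at most the three vertices of the lattice triangle under `q`);
for a `1`-separated `X ∋ q` this holds as soon as those (≤ 3) sites are balls of `X` other than `q`. -/

/-- Local form of `two_thirds_le_sq_height`: if every site of the layer within planar squared distance `1/3` of
`q`'s foot is at distance `≥ 1` from `q`, then `(q₂ − h)² ≥ 2/3`. [cite: HalesDSP2012, §1.3 p. 12 (Fig. 1.12)] -/
theorem two_thirds_le_sq_height_local (q : EuclideanSpace ℝ (Fin 3)) (c₀ c₁ h : ℝ)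
    (hlayer : ∀ a b : ℤ, (q 0 - c₀ - (a + b / 2)) ^ 2 + (q 1 - c₁ - b * (Real.sqrt 3 / 2)) ^ 2 ≤ 1 / 3 →
      ∃ p : EuclideanSpace ℝ (Fin 3),
        p 0 = c₀ + a + b / 2 ∧ p 1 = c₁ + b * (Real.sqrt 3 / 2) ∧ p 2 = h ∧ 1 ≤ ‖q - p‖) :
    2 / 3 ≤ (q 2 - h) ^ 2 := by
  obtain ⟨a, b, hab⟩ := triangular_covering_sq (q 0 - c₀) (q 1 - c₁)
  obtain ⟨p, h0, h1, h2, hq⟩ := hlayer a b hab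
  have e : (q 0 - p 0) ^ 2 + (q 1 - p 1) ^ 2
      = (q 0 - c₀ - (a + b / 2)) ^ 2 + (q 1 - c₁ - b * (Real.sqrt 3 / 2)) ^ 2 := by rw [h0, h1]; ring
  have := two_thirds_le_sq_height_of_site q p hq (by linarith)
  rwa [h2] at this

/-- Local form of `hollow_of_minimal_height`: a ball at height exactly `√(2/3)` over a layer whose sites within
planar squared distance `1/3` of the ball's foot are all at distance `≥ 1` from it sits over a hollow (letter `B`
or `C` over `A`). [cite: HalesDSP2012, §1.3 p. 12 (Fig. 1.12)] [cite: ConwaySloane1999, Ch. 4 §6.2, p. 110] -/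
theorem hollow_of_minimal_height_local (q : EuclideanSpace ℝ (Fin 3)) (c₀ c₁ h₀ : ℝ)
    (hz : q 2 = h₀ + Real.sqrt (2 / 3))
    (hlow : ∀ a b : ℤ, (q 0 - c₀ - (a + b / 2)) ^ 2 + (q 1 - c₁ - b * (Real.sqrt 3 / 2)) ^ 2 ≤ 1 / 3 →
      ∃ p : EuclideanSpace ℝ (Fin 3),
        p 0 = c₀ + a + b / 2 ∧ p 1 = c₁ + b * (Real.sqrt 3 / 2) ∧ p 2 = h₀ ∧ 1 ≤ ‖q - p‖) :
    ∃ a b : ℤ, (q 0 = c₀ + a + b / 2 + 1 / 2 ∧ q 1 = c₁ + b * (Real.sqrt 3 / 2) + Real.sqrt 3 / 6) ∨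
      (q 0 = c₀ + a + b / 2 + 1 ∧ q 1 = c₁ + b * (Real.sqrt 3 / 2) + Real.sqrt 3 / 3) := by
  have hsq : (q 2 - h₀) ^ 2 = 2 / 3 := by
    rw [hz, add_sub_cancel_left, Real.sq_sqrt (by norm_num)]
  have hfar : ∀ a b : ℤ, 1 / 3 ≤ (q 0 - c₀ - (a + b / 2)) ^ 2 + (q 1 - c₁ - b * (Real.sqrt 3 / 2)) ^ 2 := by
    intro a b
    rcases le_or_gt ((q 0 - c₀ - (a + b / 2)) ^ 2 + (q 1 - c₁ - b * (Real.sqrt 3 / 2)) ^ 2) (1 / 3) with hle | hgt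
    · obtain ⟨p, h0, h1', h2', hq⟩ := hlow a b hle
      have hn := norm_sq_fin_three (q - p)
      simp only [PiLp.sub_apply] at hn
      rw [h0, h1', h2'] at hn
      have h1sq : 1 ≤ ‖q - p‖ ^ 2 := by nlinarith [norm_nonneg (q - p)]
      nlinarith
    · exact hgt.le
  obtain ⟨a, b, hab⟩ := triangular_deep_holes (q 0 - c₀) (q 1 - c₁) hfar
  refine ⟨a, b, ?_⟩
  rcases hab with ⟨hx, hy⟩ | ⟨hx, hy⟩
  · exact Or.inl ⟨by linarith, by linarith⟩
  · exact Or.inr ⟨by linarith, by linarith⟩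

/-- **Local layer pinning.**  Two layers at heights `h₀ < h₂`, a ball `q` strictly between, and the hard core
`1 ≤ ‖q − p‖` only for the sites `p` of either layer within planar squared distance `1/3` of `q`'s foot:
`√(2/3) ≤ q₂ − h₀` and `√(2/3) ≤ h₂ − q₂`. [cite: HalesDSP2012, §1.3 p. 12 (Fig. 1.12)] -/
theorem layer_pinning_local (q : EuclideanSpace ℝ (Fin 3)) (c₀ c₁ h₀ c₀' c₁' h₂ : ℝ)
    (hq₀ : h₀ < q 2) (hq₂ : q 2 < h₂)
    (hlow : ∀ a b : ℤ, (q 0 - c₀ - (a + b / 2)) ^ 2 + (q 1 - c₁ - b * (Real.sqrt 3 / 2)) ^ 2 ≤ 1 / 3 →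
      ∃ p : EuclideanSpace ℝ (Fin 3),
        p 0 = c₀ + a + b / 2 ∧ p 1 = c₁ + b * (Real.sqrt 3 / 2) ∧ p 2 = h₀ ∧ 1 ≤ ‖q - p‖)
    (hup : ∀ a b : ℤ, (q 0 - c₀' - (a + b / 2)) ^ 2 + (q 1 - c₁' - b * (Real.sqrt 3 / 2)) ^ 2 ≤ 1 / 3 →
      ∃ p : EuclideanSpace ℝ (Fin 3),
        p 0 = c₀' + a + b / 2 ∧ p 1 = c₁' + b * (Real.sqrt 3 / 2) ∧ p 2 = h₂ ∧ 1 ≤ ‖q - p‖) :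
    Real.sqrt (2 / 3) ≤ q 2 - h₀ ∧ Real.sqrt (2 / 3) ≤ h₂ - q 2 := by
  have h1 := two_thirds_le_sq_height_local q c₀ c₁ h₀ hlow
  have h2 := two_thirds_le_sq_height_local q c₀' c₁' h₂ hup
  have h2' : 2 / 3 ≤ (h₂ - q 2) ^ 2 := by nlinarith
  constructor
  · have := Real.sqrt_le_sqrt h1
    rwa [Real.sqrt_sq (by linarith)] at this
  · have := Real.sqrt_le_sqrt h2'
    rwa [Real.sqrt_sq (by linarith)] at this

/-- **Local pinning at the minimal separation** `h₂ − h₀ = 2√(2/3)`: the ball sits at mid-height over a hollow of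
the lower layer, from the LOCAL hypotheses of `layer_pinning_local` alone.
[cite: HalesDSP2012, §1.3 p. 12 (Fig. 1.12)] [cite: ConwaySloane1999, Ch. 4 §6.2, p. 110] -/
theorem layer_pinning_hollow_local (q : EuclideanSpace ℝ (Fin 3)) (c₀ c₁ h₀ c₀' c₁' h₂ : ℝ)
    (hq₀ : h₀ < q 2) (hq₂ : q 2 < h₂) (hsep : h₂ - h₀ = 2 * Real.sqrt (2 / 3))
    (hlow : ∀ a b : ℤ, (q 0 - c₀ - (a + b / 2)) ^ 2 + (q 1 - c₁ - b * (Real.sqrt 3 / 2)) ^ 2 ≤ 1 / 3 →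
      ∃ p : EuclideanSpace ℝ (Fin 3),
        p 0 = c₀ + a + b / 2 ∧ p 1 = c₁ + b * (Real.sqrt 3 / 2) ∧ p 2 = h₀ ∧ 1 ≤ ‖q - p‖)
    (hup : ∀ a b : ℤ, (q 0 - c₀' - (a + b / 2)) ^ 2 + (q 1 - c₁' - b * (Real.sqrt 3 / 2)) ^ 2 ≤ 1 / 3 →
      ∃ p : EuclideanSpace ℝ (Fin 3),
        p 0 = c₀' + a + b / 2 ∧ p 1 = c₁' + b * (Real.sqrt 3 / 2) ∧ p 2 = h₂ ∧ 1 ≤ ‖q - p‖) :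
    q 2 = h₀ + Real.sqrt (2 / 3) ∧
      ∃ a b : ℤ, (q 0 = c₀ + a + b / 2 + 1 / 2 ∧ q 1 = c₁ + b * (Real.sqrt 3 / 2) + Real.sqrt 3 / 6) ∨
        (q 0 = c₀ + a + b / 2 + 1 ∧ q 1 = c₁ + b * (Real.sqrt 3 / 2) + Real.sqrt 3 / 3) := by
  obtain ⟨h1, h2⟩ := layer_pinning_local q c₀ c₁ h₀ c₀' c₁' h₂ hq₀ hq₂ hlow hup
  have hz : q 2 = h₀ + Real.sqrt (2 / 3) := by linarith
  exact ⟨hz, hollow_of_minimal_height_local q c₀ c₁ h₀ hz hlow⟩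

/-! ## 5. Above mid-height a ball touches at most two balls of a complete layer

(The count behind «three contacts only at a hollow»: the contacts of `q` with a layer at height-distance `t`,
`t² > 2/3`, lie on a circle of squared radius `1 − t² < 1/3` about `q`'s foot, and three lattice sites pairwise
`≥ 1` apart do not fit in such a disc.) -/

/-- Minimal distance of the triangular lattice: distinct sites are `≥ 1` apart (squared, lattice coordinates).
[cite: ConwaySloane1999, Ch. 4 §6.2, p. 110 (minimal norm 1)] -/
theorem triangular_min_sq (a b a' b' : ℤ) (hne : (a, b) ≠ (a', b')) :
    (1 : ℝ) ≤ ((a : ℝ) - a' + ((b : ℝ) - b') / 2) ^ 2 + (((b : ℝ) - b') * (Real.sqrt 3 / 2)) ^ 2 := by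
  have h3 : Real.sqrt 3 ^ 2 = 3 := Real.sq_sqrt (by norm_num)
  have key : ((a : ℝ) - a' + ((b : ℝ) - b') / 2) ^ 2 + (((b : ℝ) - b') * (Real.sqrt 3 / 2)) ^ 2
      = (((a - a') ^ 2 + (a - a') * (b - b') + (b - b') ^ 2 : ℤ) : ℝ) := by
    push_cast; linear_combination (((b : ℝ) - b') ^ 2 / 4) * h3
  rw [key]
  have hpos : 0 < (a - a') ^ 2 + (a - a') * (b - b') + (b - b') ^ 2 := by
    rcases eq_or_ne (b - b') 0 with hb | hb
    · have ha : a - a' ≠ 0 := by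
        intro ha; apply hne
        rw [Prod.mk.injEq]; exact ⟨by linarith, by linarith⟩
      rw [hb]; nlinarith [sq_pos_of_ne_zero ha]
    · nlinarith [sq_pos_of_ne_zero hb, sq_nonneg (2 * (a - a') + (b - b'))]
  have h1 : (1 : ℤ) ≤ (a - a') ^ 2 + (a - a') * (b - b') + (b - b') ^ 2 := by linarith
  exact_mod_cast h1

/-- Three planar points of squared length `< 1/3` cannot be pairwise at squared distance `≥ 1`
(`Σ |uᵢ − uⱼ|² = 3 Σ |uᵢ|² − |Σ uᵢ|² < 3`). [folklore] -/
private theorem no_three_in_small_disc (u0 u1 v0 v1 w0 w1 : ℝ) (hu : u0 ^ 2 + u1 ^ 2 < 1 / 3)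
    (hv : v0 ^ 2 + v1 ^ 2 < 1 / 3) (hw : w0 ^ 2 + w1 ^ 2 < 1 / 3) (duv : 1 ≤ (v0 - u0) ^ 2 + (v1 - u1) ^ 2)
    (duw : 1 ≤ (w0 - u0) ^ 2 + (w1 - u1) ^ 2) (dvw : 1 ≤ (w0 - v0) ^ 2 + (w1 - v1) ^ 2) : False := by
  nlinarith [sq_nonneg (u0 + v0 + w0), sq_nonneg (u1 + v1 + w1)]

/-- Planar offset bookkeeping: the lattice-coordinate squared distance of two sites equals the squared distance
of their offsets from a common point. [folklore] -/
private theorem site_diff_sq (x0 x1 c₀ c₁ : ℝ) (a b a' b' : ℝ) :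
    (a - a' + (b - b') / 2) ^ 2 + ((b - b') * (Real.sqrt 3 / 2)) ^ 2
      = ((x0 - c₀ - (a' + b' / 2)) - (x0 - c₀ - (a + b / 2))) ^ 2
        + ((x1 - c₁ - b' * (Real.sqrt 3 / 2)) - (x1 - c₁ - b * (Real.sqrt 3 / 2))) ^ 2 := by
  ring

/-- **At most two contacts above mid-height.**  If `(q₂ − h)² > 2/3` then at most two sites of the layer
`(c₀ + a + b/2, c₁ + b√3/2, h)` are at distance exactly `1` from `q` (for `(q₂ − h)² = 2/3` there can be three:
the hollow, `layer_pinning_contact`). [cite: HalesDSP2012, §1.3 p. 12 (Fig. 1.12)] -/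
theorem card_layer_contacts_le_two (q : EuclideanSpace ℝ (Fin 3)) (c₀ c₁ h : ℝ) (ht : 2 / 3 < (q 2 - h) ^ 2)
    (S : Finset (ℤ × ℤ))
    (hS : ∀ ab ∈ S, ∃ p : EuclideanSpace ℝ (Fin 3), p 0 = c₀ + ab.1 + ab.2 / 2 ∧
      p 1 = c₁ + ab.2 * (Real.sqrt 3 / 2) ∧ p 2 = h ∧ ‖q - p‖ = 1) :
    S.card ≤ 2 := by
  by_contra hlt
  rw [not_le] at hlt
  obtain ⟨x, hx, y, hy, z, hz, hxy, hxz, hyz⟩ := Finset.two_lt_card.1 hlt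
  -- planar offsets of contact sites are `< 1/3` in square
  have hplanar : ∀ ab ∈ S, (q 0 - c₀ - (ab.1 + ab.2 / 2)) ^ 2
      + (q 1 - c₁ - ab.2 * (Real.sqrt 3 / 2)) ^ 2 < 1 / 3 := by
    intro ab hab
    obtain ⟨p, h0, h1, h2, hq⟩ := hS ab hab
    have hn := norm_sq_fin_three (q - p)
    simp only [PiLp.sub_apply] at hn
    rw [hq, one_pow, h0, h1, h2] at hn
    nlinarith
  have dxy := triangular_min_sq x.1 x.2 y.1 y.2 (by rwa [Prod.mk.eta, Prod.mk.eta])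
  have dxz := triangular_min_sq x.1 x.2 z.1 z.2 (by rwa [Prod.mk.eta, Prod.mk.eta])
  have dyz := triangular_min_sq y.1 y.2 z.1 z.2 (by rwa [Prod.mk.eta, Prod.mk.eta])
  rw [site_diff_sq (q 0) (q 1) c₀ c₁] at dxy dxz dyz
  exact no_three_in_small_disc _ _ _ _ _ _ (hplanar x hx) (hplanar y hy) (hplanar z hz) dxy dxz dyz

end Literature.Geometry.DiscreteGeometry
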